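import Summits.AtomisticToContinuum.BoseEinsteinCondensation.Theorems.BECRieszReverseHolderMicroscaleFlatness
import Summits.AtomisticToContinuum.BoseEinsteinCondensation.Theorems.BECRieszReverseHolderTwoScaleGlue
import Summits.AtomisticToContinuum.BoseEinsteinCondensation.Theorems.BECRieszReverseHolderGroundStateEnergyFinite
import Summits.AtomisticToContinuum.BoseEinsteinCondensation.Theorems.BECRieszReverseHolderPositiveNearMinimiserExists
import Summits.AtomisticToContinuum.BoseEinsteinCondensation.Theorems.BECRieszReverseHolderPositivityTransfer
import Summits.AtomisticToContinuum.BoseEinsteinCondensation.Theorems.BECRieszReverseHolderAssembly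
import Summits.AtomisticToContinuum.BoseEinsteinCondensation.Theorems.BECRieszReverseHolderCoarseGrainedReverseHolderReduction
import HarnessLib

/-!
# Route `BECRieszReverseHolder`, crux `CoarseGrainedReverseHolder` (stmt-AtomisticToContinuum-12840):
# what the crux alone delivers in the tree of 2026-08-17

Supports (does not close) stmt-AtomisticToContinuum-12840 (line `registered`, lead c4). With the
route items `MicroscaleFlatness` (stmt-AtomisticToContinuum-12842, `microscaleFlatness_proof`) and
`TwoScaleGlue` (stmt-AtomisticToContinuum-12843, `twoScaleGlue_proof`) PROVED, the crux
`CoarseGrainedReverseHolder` — equivalently (landed reduction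
`coarseGrainedReverseHolder_iff_groundStates`) the `N`-uniform bound on the coarse-grained
reverse-Hölder functional `F_{n,ℓ}` over non-negative GROUND STATES — yields by itself the route
target `PositiveZeroMode` (flat-mode occupation `≥ cN` of every non-negative `δ`-near-minimiser of the
dilute gas in the thermodynamic limit, `δ` after `N`), and together with the one remaining open frame
item `GroundStateRigidity` (stmt-AtomisticToContinuum-9072) the sub-problem statement
`BoseEinsteinCondensation`. These three kernel-checked implications are the lead's evidence that the
two open stubs of line `registered` (`stub_groundStateShadowDomination` = the typed informal item
stmt-AtomisticToContinuum-12602 `BoseRieszMembership`, and `stub_rieszShadowFieldMoment` = item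
stmt-AtomisticToContinuum-12841) carry content at least as strong as zero-temperature Bose–Einstein
condensation of the dilute repulsive gas in the thermodynamic limit [LSSY2005, Ch. 5]: no further
provable-now layer separates the line from that open problem.

Pure logic over landed theorems; no analytic content lives here.

## References

* [LSSY2005] E. H. Lieb, R. Seiringer, J. P. Solovej, J. Yngvason, *The Mathematics of the Bose Gas
  and its Condensation* (2005), Ch. 5.
-/

namespace Summit.AtomisticToContinuum.BoseEinsteinCondensation.Theorems.CoarseGrainedReverseHolder

open Literature.MathematicalPhysics.QuantumManyBody
open Summit.AtomisticToContinuum.BoseEinsteinCondensation.Theses.BECRieszReverseHolder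

/-- **The crux alone gives the route target.** `CoarseGrainedReverseHolder → PositiveZeroMode`:
the proved glue `TwoScaleGlue` (stmt-AtomisticToContinuum-12843) applied to the crux and the proved
microscale crux `MicroscaleFlatness` (stmt-AtomisticToContinuum-12842). [folklore] -/
theorem positiveZeroMode_of_coarseGrainedReverseHolder :
    CoarseGrainedReverseHolder → PositiveZeroMode := fun hCG =>
  twoScaleGlue_proof hCG microscaleFlatness_proof

/-- **The ground-state bound alone gives the route target.** An `N`-uniform bound on the
coarse-grained reverse-Hölder functional `F_{n,ℓ}(Φ) = m³ ∫dX̂ Σ_Q (∫_Q |Φ(y,X̂)|²)² / ∫ |Φ(y,X̂)|²`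
over non-negative ground states `Φ` of the Dirichlet `(n+1)`-boson problem in the box of side
`((n+1)/ρ)^{1/3}`, at every resolution `ℓ` and small `ρ`, implies `PositiveZeroMode`: the landed
first layer of line `registered` (`stub_cruxOfGroundStateBound`: compactness + `L²`-Lipschitz
transfer to near-minimisers) followed by `positiveZeroMode_of_coarseGrainedReverseHolder`. [folklore] -/
theorem positiveZeroMode_of_groundStateBound : (∀ v : ℝ → ENNReal, BoseGas.IsRepulsiveFiniteRange v → ∃ ρ₀ : ℝ, 0 < ρ₀ ∧ ∀ ρ : ℝ, 0 < ρ → ρ < ρ₀ → ∀ ℓ : ℝ, 0 < ℓ → ∃ C : ℝ, ∀ᶠ n : ℕ in Filter.atTop, ∀ Φ : BoseGas.Config (n + 1) → ℂ, BoseGas.IsGroundState v (BoseGas.sideLength ρ (n + 1)) Φ → (∀ X, Φ X = (‖Φ X‖ : ℂ)) → let L := BoseGas.sideLength ρ (n + 1); let m := ⌊L / ℓ⌋₊; (m : ENNReal) ^ 3 * ∫⁻ X : Fin n → EuclideanSpace ℝ (Fin 3), ((∑ k : Fin 3 → Fin m, (∫⁻ y in {y : EuclideanSpace ℝ (Fin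 3) | ∀ i, y i ∈ Set.Ico ((k i : ℝ) * (L / m)) (((k i : ℝ) + 1) * (L / m))}, (‖Φ (Matrix.vecCons y X)‖₊ : ENNReal) ^ 2) ^ 2) / (∫⁻ y, (‖Φ (Matrix.vecCons y X)‖₊ : ENNReal) ^ 2)) ≤ ENNReal.ofReal C) → PositiveZeroMode := fun hGS =>
  positiveZeroMode_of_coarseGrainedReverseHolder (stub_cruxOfGroundStateBound hGS)

/-- **The crux and the frame item `GroundStateRigidity` give the sub-problem statement.**
`CoarseGrainedReverseHolder → GroundStateRigidity → BoseEinsteinCondensation`: the route assembly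
(stmt-AtomisticToContinuum-12847, `becRieszReverseHolder_assembly_proof`) with its six proved
hypotheses discharged (`microscaleFlatness_proof`, `twoScaleGlue_proof`,
`groundStateEnergyFinite_proof`, `positiveNearMinimiserExists_proof`, `OccupationStability_holds`,
`positivityTransfer_proof`). CONDITIONAL on the two open route items named in its hypotheses; it
closes nothing and is recorded here only to certify what the crux is worth. [folklore] -/
theorem boseEinsteinCondensation_of_coarseGrainedReverseHolder_of_groundStateRigidity :
    CoarseGrainedReverseHolder → GroundStateRigidity → _root_.BoseEinsteinCondensation := fun hCG hRig =>
  becRieszReverseHolder_assembly_proof hCG microscaleFlatness_proof twoScaleGlue_proof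
    groundStateEnergyFinite_proof hRig positiveNearMinimiserExists_proof OccupationStability_holds
    positivityTransfer_proof

end Summit.AtomisticToContinuum.BoseEinsteinCondensation.Theorems.CoarseGrainedReverseHolder
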